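import Mathlib
import Literature.NumberTheory.Congruences.ZolotarevLemmaJacobi
import HarnessLib

/-!
# The signature of a sum and of a product of permutations: `ϵ(S(σ)) = ∏ ϵ(σ_i)` and `ϵ(P(σ)) = ∏ ϵ(σ_i)^{n/n_i}`
# (Brunyate–Clark, *Extending the Zolotarev–Frobenius approach to quadratic reciprocity*, §1.1, Lemma 1.2 (Sum Lemma) and
# Lemma 1.3 (Product Lemma))

Layer `Literature/GroupTheory`, namespace `Literature.GroupTheory`; lane `lit-hodgefound` (Track 2 foundations library), prover
seat `lit-hodgefound-p06`, generation 50, self-proposed row g50-#4. Theorems only: no definition, no instance, no notation,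
no named fact. The two-set case of the Product Lemma is `NumberTheory/Congruences/ZolotarevLemmaJacobi.sign_prodCongr`
(g49-#1, Lemmermeyer's (3.3)); Mathlib has the fibrewise forms `Perm.sign_prodCongrRight/Left`, `sign_sumCongr`,
`sign_prodExtendRight`, but neither the `Σ`- nor the `Π`-indexed statement.

## Source, verbatim ([BrunyateClark2014] §1.1, held `paper:doi-10-1007-s11139-014-9635-y` pp. 5–6)

"The proofs of the following two results are routine, and we omit them. **Lemma 1.2 (Sum Lemma).** Let `X_1, …, X_r` be
finite sets, and let `S : ∏_{i=1}^r Sym X_i → Sym ⨿_{i=1}^r X_i` be the natural map: `σ = (σ_1, …, σ_r) ↦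
(x_i ∈ X_i ↦ σ_i(x_i))`. Then for all `σ = (σ_1, …, σ_r) ∈ ∏ Sym X_i`, we have (1) `ϵ(S(σ)) = ∏_{i=1}^r ϵ(σ_i)`.
**Lemma 1.3 (Product Lemma).** Let `X_1, …, X_r` be nonempty finite sets, with `n_i = #X_i`. Put `X = ∏ X_i` and
`n = ∏ n_i`. Let `P : ∏ Sym X_i → Sym X` be the natural map: `P : (σ_1, …, σ_r) ↦ ((x_1, …, x_r) ↦ (σ_1(x_1), …, σ_r(x_r)))`.
a) Then, for all `σ = (σ_1, …, σ_r) ∈ ∏ Sym X_i`, we have (2) `ϵ(P(σ)) = ∏_{i=1}^r ϵ(σ_i)^{n/n_i}`. b) In particular if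
each `n_i` is odd, then (3) `ϵ(P(σ)) = ∏_{i=1}^r ϵ(σ_i)`."

## What is typed (any finite index type `ι` in place of `{1, …, r}`; `X = β : ι → Type`)

`S` is Mathlib's `Equiv.Perm.sigmaCongrRight : (∀ i, Perm (β i)) → Perm (Σ i, β i)` (a monoid hom, `sigmaCongrRightHom`),
`P` is `Equiv.piCongrRight : (∀ i, Perm (β i)) → Perm (∀ i, β i)`. Both are computed by decomposing `σ = ∏ᵢ (1, …, σ_i, …, 1)`
(`Finset.noncommProd_mulSingle`) and treating one coordinate: on `Σ` the single-coordinate permutation is `τ` extended by the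
identity (`Perm.ofSubtype`, `sign_ofSubtype`); on `Π` it is, along `Equiv.piSplitAt i`, `#(∏_{j ≠ i} X_j)` copies of `τ`
(`Perm.sign_prodCongrLeft`).
* `sign_sigmaCongrRight_mulSingle`, **`sign_sigmaCongrRight`** — Lemma 1.2, (1);
* `sign_piCongrRight_mulSingle`, **`sign_piCongrRight`** — Lemma 1.3 (a) with exponent `∏_{j ≠ i} n_j` (no non-emptiness
  needed; read in `ℤ`), `sign_piCongrRight_eq_prod_pow_card_div` — (2) with the printed `n/n_i` for nonempty `X_i`,
  **`sign_piCongrRight_of_odd_card`** — Lemma 1.3 (b), (3).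

## References

* [BrunyateClark2014] A. Brunyate, P. L. Clark, *Extending the Zolotarev–Frobenius approach to quadratic reciprocity*,
  Ramanujan J. 37 (2015) 25–50, §1.1 Lemma 1.2, Lemma 1.3.
-/

open Equiv Equiv.Perm Finset

namespace Literature.GroupTheory

variable {ι : Type*} [Fintype ι] [DecidableEq ι] {β : ι → Type*} [∀ i, Fintype (β i)] [∀ i, DecidableEq (β i)]

/-! ### Lemma 1.2 (Sum Lemma) -/

/-- One summand: the permutation of `⨿ X_j` which is `τ` on `X_i` and the identity on the other `X_j` has the signature of
`τ`. [cite: BrunyateClark2014, §1.1 Lemma 1.2 (proof, "routine")] -/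
theorem sign_sigmaCongrRight_mulSingle (i : ι) (τ : Perm (β i)) :
    Perm.sign (Perm.sigmaCongrRight (Pi.mulSingle i τ) : Perm (Σ j, β j)) = Perm.sign τ := by
  set S : Perm (Σ j, β j) := Perm.sigmaCongrRight (Pi.mulSingle i τ) with hS
  have hSapp : ∀ x : Σ j, β j, S x = ⟨x.1, Pi.mulSingle (M := fun j => Perm (β j)) i τ x.1 x.2⟩ := fun x => rfl
  -- `S` moves only points of the fibre `X_i`
  have h₁ : ∀ x : Σ j, β j, (fun x : Σ j, β j => x.1 = i) (S x) ↔ (fun x : Σ j, β j => x.1 = i) x := fun x => by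
    rw [hSapp]
  have h₂ : ∀ x : Σ j, β j, S x ≠ x → (fun x : Σ j, β j => x.1 = i) x := by
    intro x hx
    by_contra hne
    apply hx
    rw [hSapp, Pi.mulSingle_eq_of_ne hne, Perm.one_apply]
  rw [← ofSubtype_subtypePerm h₁ h₂, sign_ofSubtype]
  -- the fibre `{x | x.1 = i}` is `X_i`, and `S` is `τ` there
  symm
  refine sign_eq_sign_of_equiv τ (S.subtypePerm h₁)
    (Equiv.ofBijective (fun b : β i => (⟨⟨i, b⟩, rfl⟩ : {x : Σ j, β j // x.1 = i})) ⟨fun b b' h => ?_, fun x => ?_⟩)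
    fun b => ?_
  · simpa using h
  · obtain ⟨⟨j, b⟩, hj⟩ := x
    dsimp only at hj
    subst hj
    exact ⟨b, rfl⟩
  · refine Subtype.ext ?_
    change (⟨i, τ b⟩ : Σ j, β j) = S ⟨i, b⟩
    rw [hSapp, Pi.mulSingle_eq_same]

/-- **LEMMA 1.2 (Sum Lemma)**: "Let `X_1, …, X_r` be finite sets, and let `S : ∏ Sym X_i → Sym ⨿ X_i` be the natural map:
`σ = (σ_1, …, σ_r) ↦ (x_i ∈ X_i ↦ σ_i(x_i))`. Then for all `σ`, (1) `ϵ(S(σ)) = ∏ ϵ(σ_i)`." Here `S` is Mathlib's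
`Equiv.Perm.sigmaCongrRight` on `Σ i, X_i`, for any finite index type. [cite: BrunyateClark2014, §1.1 Lemma 1.2 (Sum Lemma)] -/
theorem sign_sigmaCongrRight (σ : ∀ i, Perm (β i)) :
    Perm.sign (Perm.sigmaCongrRight σ : Perm (Σ j, β j)) = ∏ i, Perm.sign (σ i) := by
  have hdec : Perm.sigmaCongrRight σ =
      (Perm.sigmaCongrRightHom β) (univ.noncommProd (fun i => Pi.mulSingle i (σ i))
        fun i _ j _ _ => Pi.mulSingle_apply_commute σ i j) := by
    rw [noncommProd_mulSingle σ, sigmaCongrRightHom_apply]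
  rw [hdec, ← MonoidHom.comp_apply, map_noncommProd, noncommProd_eq_prod]
  refine prod_congr rfl fun i _ => ?_
  rw [MonoidHom.comp_apply, sigmaCongrRightHom_apply, sign_sigmaCongrRight_mulSingle]

/-! ### Lemma 1.3 (Product Lemma) -/

/-- One factor: the permutation of `∏ X_j` which is `τ` in the coordinate `i` and the identity in the others is
`#(∏_{j ≠ i} X_j)` disjoint copies of `τ`, of signature `ϵ(τ)^{∏_{j ≠ i} n_j}` (read in `ℤ`).
[cite: BrunyateClark2014, §1.1 Lemma 1.3 (a) (proof, "routine")] -/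
theorem sign_piCongrRight_mulSingle (i : ι) (τ : Perm (β i)) :
    ((Perm.sign (Equiv.piCongrRight (Pi.mulSingle (M := fun j => Perm (β j)) i τ) : Perm (∀ j, β j)) : ℤˣ) : ℤ) =
      (Perm.sign τ : ℤ) ^ ∏ j ∈ univ.erase i, Fintype.card (β j) := by
  have hcomm : ∀ f : ∀ j, β j,
      Equiv.piSplitAt i β (Equiv.piCongrRight (Pi.mulSingle (M := fun j => Perm (β j)) i τ) f) =
        (prodCongrLeft fun _ : (∀ j : {j // j ≠ i}, β j) => τ) (Equiv.piSplitAt i β f) := by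
    intro f
    refine Prod.ext ?_ (funext fun j => ?_)
    · show (Equiv.piCongrRight (Pi.mulSingle (M := fun j => Perm (β j)) i τ) f) i = τ (f i)
      simp
    · show (Equiv.piCongrRight (Pi.mulSingle (M := fun j => Perm (β j)) i τ) f) j = f j
      simp [Pi.mulSingle_eq_of_ne j.2]
  rw [sign_eq_sign_of_equiv _ _ (Equiv.piSplitAt i β) hcomm, sign_prodCongrLeft, prod_const, card_univ,
    Units.val_pow_eq_pow_val, Fintype.card_pi]
  congr 1
  symm
  convert prod_subtype (univ.erase i) (p := fun j => j ≠ i) (fun j => by simp) fun j => Fintype.card (β j)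

/-- **LEMMA 1.3 (a) (Product Lemma)**: "Let `X_1, …, X_r` be nonempty finite sets, with `n_i = #X_i`. Put `X = ∏ X_i` and
`n = ∏ n_i`. Let `P : ∏ Sym X_i → Sym X` be the natural map: `P : (σ_1, …, σ_r) ↦ ((x_1, …, x_r) ↦ (σ_1(x_1), …, σ_r(x_r)))`.
a) Then, for all `σ`, (2) `ϵ(P(σ)) = ∏ ϵ(σ_i)^{n/n_i}`" — here with the exponent written `∏_{j ≠ i} n_j` (`= n/n_i`; this form
needs no non-emptiness), read in `ℤ`; `P` = Mathlib's `Equiv.piCongrRight`, any finite index type. (The two-factor case is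
`ZolotarevLemmaJacobi.sign_prodCongr`.) [cite: BrunyateClark2014, §1.1 Lemma 1.3 (a) (Product Lemma)] -/
theorem sign_piCongrRight (σ : ∀ i, Perm (β i)) :
    ((Perm.sign (Equiv.piCongrRight σ : Perm (∀ j, β j)) : ℤˣ) : ℤ) =
      ∏ i, (Perm.sign (σ i) : ℤ) ^ ∏ j ∈ univ.erase i, Fintype.card (β j) := by
  -- `P` is a homomorphism
  let Φ : (∀ j, Perm (β j)) →* Perm (∀ j, β j) :=
    { toFun := fun σ => Equiv.piCongrRight σ
      map_one' := Equiv.ext fun f => funext fun j => rfl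
      map_mul' := fun σ τ => Equiv.ext fun f => funext fun j => rfl }
  have hΦ : ∀ σ : ∀ j, Perm (β j), (Equiv.piCongrRight σ : Perm (∀ j, β j)) = Φ σ := fun σ => rfl
  have hdec : Φ σ = Φ (univ.noncommProd (fun i => Pi.mulSingle i (σ i))
      fun i _ j _ _ => Pi.mulSingle_apply_commute σ i j) := by
    rw [noncommProd_mulSingle σ]
  rw [hΦ, hdec, ← MonoidHom.comp_apply, map_noncommProd, noncommProd_eq_prod, Units.coe_prod]
  refine prod_congr rfl fun i _ => ?_
  rw [MonoidHom.comp_apply, ← hΦ, sign_piCongrRight_mulSingle]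

/-- **LEMMA 1.3 (a)** with the printed exponent `n/n_i`, `n = #X = ∏ n_j`, for NONEMPTY `X_j` (read in `ℤ`).
[cite: BrunyateClark2014, §1.1 Lemma 1.3 (a) eq. (2)] -/
theorem sign_piCongrRight_eq_prod_pow_card_div [∀ i, Nonempty (β i)] (σ : ∀ i, Perm (β i)) :
    ((Perm.sign (Equiv.piCongrRight σ : Perm (∀ j, β j)) : ℤˣ) : ℤ) =
      ∏ i, (Perm.sign (σ i) : ℤ) ^ (Fintype.card (∀ j, β j) / Fintype.card (β i)) := by
  rw [sign_piCongrRight]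
  refine prod_congr rfl fun i _ => ?_
  rw [Fintype.card_pi, ← mul_prod_erase univ (fun j => Fintype.card (β j)) (mem_univ i),
    Nat.mul_div_cancel_left _ Fintype.card_pos]

/-- **LEMMA 1.3 (b)**: "In particular if each `n_i` is odd, then (3) `ϵ(P(σ)) = ∏ ϵ(σ_i)`."
[cite: BrunyateClark2014, §1.1 Lemma 1.3 (b)] -/
theorem sign_piCongrRight_of_odd_card (hodd : ∀ i, Odd (Fintype.card (β i))) (σ : ∀ i, Perm (β i)) :
    Perm.sign (Equiv.piCongrRight σ : Perm (∀ j, β j)) = ∏ i, Perm.sign (σ i) := by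
  refine Units.ext ?_
  rw [sign_piCongrRight, Units.coe_prod]
  refine prod_congr rfl fun i _ => ?_
  exact Literature.NumberTheory.Congruences.Zolotarev.units_int_pow_of_odd _
    (prod_induction _ Odd (fun a b ha hb => ha.mul hb) odd_one fun j _ => hodd j)

end Literature.GroupTheory
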